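import Mathlib.LinearAlgebra.Eigenspace.Pi
import Mathlib.LinearAlgebra.Eigenspace.Semisimple
import Mathlib.LinearAlgebra.Eigenspace.Triangularizable
import Mathlib.FieldTheory.Separable
import Mathlib.Algebra.DirectSum.Decomposition
import HarnessLib

/-!
# Crux `H413` — K2-LIT E3 «EllipticInputs», U12-h brick (Cl) part 1: EIGENCHARACTERS OF A COMMUTING FAMILY OF FINITE-ORDER OPERATORS —
# `W = ⊕_χ W_χ`, and what a twisted intertwiner, a fixed vector, and a non-trivial operator say about the occurring characters `χ`

Cell `hodgecm-mathlib`, Track B «K2-LIT», crux item `stmt-HodgeConjecture-24833` (h413), line `K2_E3_EllipticInputs`, unit U12 «HC characters», socket U12-h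
`sig_K2E3CharLocConstNearRegular` (‹#9L›).  Seat K2E3-p09 (g2), 9L line lead; brick (Cl) of memo v4 `K2/K2E3-p09/g2/MEMO-U12h-HF-bricks.v4.K2E3-p09-g2.md` under the DEPTH-HALVING road
(K2E1b-p08 (g2) MEMO (H2) d8755e6223fd3317); `--supports stmt-HodgeConjecture-24833 --as helper`.  THEOREMS ONLY — no `def`, no named fact, no instance, no notation, no
`sorry`.  GENERIC LINEAR ALGEBRA: a field `k` (algebraically closed of characteristic `0` where eigenvectors are needed), a finite-dimensional `k`-space `W`, a family
`f : ι → End W`.  HONEST LABEL: HC_CM is proved only modulo the 7 printed citations (2 remaining named inputs: hLiu418 = stmt-HodgeConjecture-24832, h413 =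
stmt-HodgeConjecture-24833) until rung 0 closes; this file is a count-neutral engine.

THE MATHEMATICS (the abelian-layer «Clifford» bookkeeping of Harish-Chandra's finiteness argument, [HarishChandra1999] §§17–19 with Howe's Theorem 17.1 replaced by its shadow
on an ABELIAN layer `A = K_{N′} ∕ K_N` of a compact open subgroup; [Serre1977] §2.6, §8.1 Prop. 24).  In the application `W` is a `K₁`-type `c` (an isotypic component of a level
space `V^{K′}`), `ι = A` and `f a = L_a|_c`: a commuting family of operators of finite order.  Over an algebraically closed field of characteristic `0` each `f i` is
semisimple (`X^n − 1` is separable), so the commuting family is simultaneously diagonalisable: with the EIGENCHARACTER SPACES `W_χ := ⋂_i ker(f i − χ i)` (`χ : ι → k`),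
**`W = ⊕_χ W_χ`** (Mathlib's simultaneous generalised-eigenspace decomposition for commuting triangularisable families + semisimplicity).  A character `χ` OCCURS when
`W_χ ≠ 0`.  Consequences used by the depth-halving argument (memo v4 §1 (C1)–(C3)):
* §1 `isSemisimple_of_pow_eq_one`; **`iSup_iInf_eigenspace_eq_top`**, **`iSupIndep_iInf_eigenspace`**, `isInternal_iInf_eigenspace` (the decomposition).
* §2 occurring characters are multiplicative where the family is (`apply_eq_mul_of_ne_bot`), `= 1` where the operator is `1` (`apply_eq_one_of_ne_bot`).
* §3 `exists_common_eigenvector_of_invariant` (a non-zero invariant subspace carries a common eigenvector) and **`exists_ne_bot_of_forall_apply_eq_smul`**: a non-zero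
  vector on which the sub-family `i ∈ S` acts by scalars `μ i` forces an occurring `χ` with `χ = μ` on `S` — whence (iv) «an `(A ∩ H)`-FIXED vector `≠ 0` ⇒ some occurring `χ` is trivial on `A ∩ H`» (`exists_ne_bot_of_forall_apply_eq_self`) and
  (iii) **`exists_pair_of_twisted_intertwiner`**: «`T ≠ 0` with `f i ∘ T = T ∘ f (θ i)` (`i ∈ S`) ⇒ occurring `χ₁, χ₂` with `χ₂ = χ₁ ∘ θ` on `S`» (Harish-Chandra's «`y`
  intertwines `d` ⇒ the characters match on the overlap», the input of ★ p855559 (H3-lite) (C)).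
* §4 (ii)-input `apply_mem_iInf_eigenspace_of_forall_mul_eq` («`u f i = f (π i) u` ⇒ `u W_χ ⊆ W_{χ ∘ π⁻¹}`», the `K₁`-permutation of the eigencharacter spaces) and the DEPTH
  criterion **`eq_one_of_forall_ne_bot_apply_eq_one`** («every occurring `χ` has `χ i = 1` ⇒ `f i = 1`»): the depth of the type is the largest depth of an occurring character.

## References
* [HarishChandra1999] Harish-Chandra (notes by S. DeBacker and P. J. Sally, Jr.), *Admissible Invariant Distributions on Reductive p-adic Groups*, ULECT 16, AMS (1999): §17
  (Thm. 17.1, Cor. 17.2), §19 (Lemmas 19.2–19.4), pp. 84–86.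
* [Serre1977] J.-P. Serre, *Linear Representations of Finite Groups*, GTM 42 (1977): §2.6 Thm. 8, §8.1 Prop. 24 (Clifford: restriction to an abelian normal subgroup).
-/

set_option autoImplicit false
-- the mandated namespace repeats `HodgeConjecture.HodgeConjecture`, as in every `Theorems/*.lean` of this sub-problem
set_option linter.dupNamespace false

noncomputable section

open Polynomial Module Set
open scoped DirectSum

namespace Summit.HodgeConjecture.HodgeConjecture.Cruxes.H413.K2E3AbelianLayerEigencharacters

variable {k W : Type*} [Field k] [AddCommGroup W] [Module k W]

/-! ## §1 The simultaneous eigen-decomposition `W = ⊕_χ W_χ` of a commuting family of finite-order operators -/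

section Decomposition

/-- **An operator of finite order is semisimple** in characteristic `0`: `f^n = 1` (`n ≥ 1`) ⇒ `f` is annihilated by the separable polynomial `X^n − 1` (Mathlib
`isSemisimple_of_squarefree_aeval_eq_zero`, `separable_X_pow_sub_C`). [cite: Serre1977, §2.6 Thm. 8] -/
theorem isSemisimple_of_pow_eq_one [CharZero k] {f : Module.End k W} {n : ℕ} (hn : 0 < n) (hf : f ^ n = 1) : f.IsSemisimple := by
  refine Module.End.isSemisimple_of_squarefree_aeval_eq_zero (p := X ^ n - C (1 : k)) ?_ ?_
  · exact (Polynomial.separable_X_pow_sub_C (1 : k) (Nat.cast_ne_zero.2 hn.ne') one_ne_zero).squarefree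
  · rw [map_sub, map_pow, aeval_X, aeval_C, map_one, hf, sub_self]

variable [IsAlgClosed k] [CharZero k] [FiniteDimensional k W] {ι : Type*} (f : ι → Module.End k W)

/-- **`⨆_χ W_χ = W`**: a commuting family of finite-order operators on a finite-dimensional space over an algebraically closed field of characteristic `0` is simultaneously
diagonalisable — the eigencharacter spaces `W_χ = ⨅_i ker(f i − χ i)`, `χ : ι → k`, span `W` (Mathlib: commuting triangularisable families have
`⨆_χ ⨅_i maxGenEigenspace = ⊤`; semisimple operators have `maxGenEigenspace = eigenspace`). [cite: Serre1977, §2.6 Thm. 8] -/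
theorem iSup_iInf_eigenspace_eq_top (hcomm : ∀ i j, Commute (f i) (f j)) (hfin : ∀ i, ∃ n : ℕ, 0 < n ∧ f i ^ n = 1) :
    ⨆ χ : ι → k, ⨅ i, (f i).eigenspace (χ i) = ⊤ := by
  have hrw : ∀ i μ, (f i).maxGenEigenspace μ = (f i).eigenspace μ := fun i μ => by
    obtain ⟨n, hn, h⟩ := hfin i
    exact (isSemisimple_of_pow_eq_one hn h).isFinitelySemisimple.maxGenEigenspace_eq_eigenspace μ
  have h := Module.End.iSup_iInf_maxGenEigenspace_eq_top_of_iSup_maxGenEigenspace_eq_top_of_commute f (fun i j _ => hcomm i j)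
    (fun i => Module.End.iSup_maxGenEigenspace_eq_top (f i))
  simp only [hrw] at h
  exact h

omit [IsAlgClosed k] [FiniteDimensional k W] in
/-- **The eigencharacter spaces `W_χ` are independent** (distinct `χ` ⇒ the sum is direct; Mathlib `independent_iInf_maxGenEigenspace_of_forall_mapsTo` for the commuting family,
read on eigenspaces by semisimplicity). [cite: Serre1977, §2.6 Thm. 8] -/
theorem iSupIndep_iInf_eigenspace (hcomm : ∀ i j, Commute (f i) (f j)) (hfin : ∀ i, ∃ n : ℕ, 0 < n ∧ f i ^ n = 1) :
    iSupIndep fun χ : ι → k => ⨅ i, (f i).eigenspace (χ i) := by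
  have hrw : ∀ i μ, (f i).maxGenEigenspace μ = (f i).eigenspace μ := fun i μ => by
    obtain ⟨n, hn, h⟩ := hfin i
    exact (isSemisimple_of_pow_eq_one hn h).isFinitelySemisimple.maxGenEigenspace_eq_eigenspace μ
  have h := Module.End.independent_iInf_maxGenEigenspace_of_forall_mapsTo f fun i j φ => Module.End.mapsTo_maxGenEigenspace_of_comm (hcomm j i) φ
  simp only [hrw] at h
  exact h

/-- **`W = ⊕_χ W_χ` as an internal direct sum** (`iSup_iInf_eigenspace_eq_top` + `iSupIndep_iInf_eigenspace`). [cite: Serre1977, §2.6 Thm. 8] -/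
theorem isInternal_iInf_eigenspace [DecidableEq (ι → k)] (hcomm : ∀ i j, Commute (f i) (f j)) (hfin : ∀ i, ∃ n : ℕ, 0 < n ∧ f i ^ n = 1) :
    DirectSum.IsInternal fun χ : ι → k => ⨅ i, (f i).eigenspace (χ i) :=
  DirectSum.isInternal_submodule_of_iSupIndep_of_iSup_eq_top (iSupIndep_iInf_eigenspace f hcomm hfin) (iSup_iInf_eigenspace_eq_top f hcomm hfin)

end Decomposition

/-! ## §2 Occurring characters are characters -/

section Character

variable {ι : Type*} (f : ι → Module.End k W)

omit [AddCommGroup W] in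
/-- On `W_χ` the operator `f i` is the scalar `χ i`. [folklore] -/
theorem apply_eq_smul_of_mem_iInf_eigenspace {W : Type*} [AddCommGroup W] [Module k W] (f : ι → Module.End k W) {χ : ι → k} {w : W}
    (hw : w ∈ ⨅ i, (f i).eigenspace (χ i)) (i : ι) : f i w = χ i • w :=
  Module.End.mem_eigenspace_iff.1 ((Submodule.mem_iInf _).1 hw i)

/-- **An occurring character is multiplicative where the family is**: `W_χ ≠ 0` and `f i ∘ f j = f l` ⇒ `χ l = χ i * χ j` (in the application `l = i j` in the layer `A`).
[cite: Serre1977, §8.1 Prop. 24] -/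
theorem apply_eq_mul_of_ne_bot {χ : ι → k} (hχ : (⨅ i, (f i).eigenspace (χ i)) ≠ ⊥) {i j l : ι} (h : f i * f j = f l) : χ l = χ i * χ j := by
  obtain ⟨w, hw, hw0⟩ := Submodule.exists_mem_ne_zero_of_ne_bot hχ
  have h1 : f l w = (χ i * χ j) • w := by
    rw [← h, Module.End.mul_apply, apply_eq_smul_of_mem_iInf_eigenspace f hw j, map_smul, apply_eq_smul_of_mem_iInf_eigenspace f hw i, smul_smul, mul_comm]
  rw [apply_eq_smul_of_mem_iInf_eigenspace f hw l] at h1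
  exact smul_left_injective k hw0 h1

/-- **An occurring character is `1` where the operator is `1`**: `W_χ ≠ 0`, `f i = 1` ⇒ `χ i = 1` (in the application: `χ` is trivial on the part of the layer acting trivially
on the type, e.g. on `K_N`). [cite: Serre1977, §8.1 Prop. 24] -/
theorem apply_eq_one_of_ne_bot {χ : ι → k} (hχ : (⨅ i, (f i).eigenspace (χ i)) ≠ ⊥) {i : ι} (h : f i = 1) : χ i = 1 := by
  obtain ⟨w, hw, hw0⟩ := Submodule.exists_mem_ne_zero_of_ne_bot hχ
  have h1 := apply_eq_smul_of_mem_iInf_eigenspace f hw i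
  rw [h, Module.End.one_apply] at h1
  exact (smul_left_injective k hw0 (show (1 : k) • w = χ i • w by rw [one_smul]; exact h1)).symm

end Character

/-! ## §3 Uniqueness of the decomposition: eigenvectors of a sub-family, fixed vectors, twisted intertwiners -/

section Consequences

variable [IsAlgClosed k] [CharZero k] [FiniteDimensional k W] {ι : Type*} (f : ι → Module.End k W)

/-- **A non-zero subspace invariant under the family carries a common eigenvector**: restrict the family to `U` (still commuting, still of finite order) and apply
`iSup_iInf_eigenspace_eq_top` on `U` — some eigencharacter space of the restricted family is non-zero. [cite: Serre1977, §2.6 Thm. 8] -/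
theorem exists_common_eigenvector_of_invariant (hcomm : ∀ i j, Commute (f i) (f j)) (hfin : ∀ i, ∃ n : ℕ, 0 < n ∧ f i ^ n = 1) {U : Submodule k W} (hU : U ≠ ⊥)
    (hinv : ∀ i, ∀ u ∈ U, f i u ∈ U) : ∃ (χ : ι → k) (u : W), u ∈ U ∧ u ≠ 0 ∧ ∀ i, f i u = χ i • u := by
  let g : ι → Module.End k U := fun i => (f i).restrict (hinv i)
  have hgcomm : ∀ i j, Commute (g i) (g j) := fun i j => LinearMap.restrict_commute (hcomm i j) _ _
  have hgfin : ∀ i, ∃ n : ℕ, 0 < n ∧ g i ^ n = 1 := fun i => by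
    obtain ⟨n, hn, h⟩ := hfin i
    refine ⟨n, hn, ?_⟩
    simp only [g]
    rw [Module.End.pow_restrict n]
    exact LinearMap.ext fun u => Subtype.ext (by rw [LinearMap.coe_restrict_apply, h, Module.End.one_apply, Module.End.one_apply])
  haveI : Nontrivial U := Submodule.nontrivial_iff_ne_bot.2 hU
  have htop := iSup_iInf_eigenspace_eq_top g hgcomm hgfin
  obtain ⟨χ, hχ⟩ : ∃ χ : ι → k, (⨅ i, (g i).eigenspace (χ i)) ≠ ⊥ := by
    by_contra h
    push Not at h
    simp only [h, iSup_bot] at htop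
    exact bot_ne_top htop
  obtain ⟨u, hu, hu0⟩ := Submodule.exists_mem_ne_zero_of_ne_bot hχ
  refine ⟨χ, (u : W), u.2, fun h => hu0 (Subtype.ext h), fun i => ?_⟩
  have h := congrArg Subtype.val (apply_eq_smul_of_mem_iInf_eigenspace g hu i)
  simpa only [g, LinearMap.coe_restrict_apply, Submodule.coe_smul] using h

/-- **A non-zero vector on which the operators `f i`, `i ∈ S`, act by scalars `μ i` forces an OCCURRING character `χ` with `χ i = μ i` for `i ∈ S`**: the subspace
`U = ⋂_{i ∈ S} ker(f i − μ i) ∋ v` is non-zero and invariant under the commuting family, so it carries a common eigenvector (`exists_common_eigenvector_of_invariant`), whose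
character agrees with `μ` on `S`. [cite: Serre1977, §2.6 Thm. 8] -/
theorem exists_ne_bot_of_forall_apply_eq_smul (hcomm : ∀ i j, Commute (f i) (f j)) (hfin : ∀ i, ∃ n : ℕ, 0 < n ∧ f i ^ n = 1) {S : Set ι} {μ : ι → k} {v : W}
    (hv : v ≠ 0) (hμ : ∀ i ∈ S, f i v = μ i • v) :
    ∃ χ : ι → k, (⨅ i, (f i).eigenspace (χ i)) ≠ ⊥ ∧ ∀ i ∈ S, χ i = μ i := by
  let U : Submodule k W := ⨅ i ∈ S, (f i).eigenspace (μ i)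
  have hvU : v ∈ U := (Submodule.mem_iInf _).2 fun i => (Submodule.mem_iInf _).2 fun hi => Module.End.mem_eigenspace_iff.2 (hμ i hi)
  have hU : U ≠ ⊥ := fun h => hv ((Submodule.mem_bot k).1 (h ▸ hvU))
  have hinv : ∀ j, ∀ u ∈ U, f j u ∈ U := fun j u hu =>
    (Submodule.mem_iInf _).2 fun i => (Submodule.mem_iInf _).2 fun hi => Module.End.mem_eigenspace_iff.2 (by
      have hui := Module.End.mem_eigenspace_iff.1 ((Submodule.mem_iInf _).1 ((Submodule.mem_iInf _).1 hu i) hi)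
      rw [← Module.End.mul_apply, (hcomm i j).eq, Module.End.mul_apply, hui, map_smul])
  obtain ⟨χ, u, huU, hu0, hu⟩ := exists_common_eigenvector_of_invariant f hcomm hfin hU hinv
  refine ⟨χ, Submodule.ne_bot_iff _ |>.2 ⟨u, (Submodule.mem_iInf _).2 fun i => Module.End.mem_eigenspace_iff.2 (hu i), hu0⟩, fun i hi => ?_⟩
  have hui := Module.End.mem_eigenspace_iff.1 ((Submodule.mem_iInf _).1 ((Submodule.mem_iInf _).1 huU i) hi)
  rw [hu i] at hui
  exact smul_left_injective k hu0 hui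

/-- **(iv) A non-zero vector FIXED by the operators `f i`, `i ∈ S`, forces an occurring character trivial on `S`** (`μ = 1` in `exists_ne_bot_of_forall_apply_eq_smul`): in the
application, a vector of the type fixed by `A ∩ x K₀′ x⁻¹` (★ L4 ∕ ★ p855602 (OCC)) gives an occurring `χ` trivial on `A ∩ x K₀′ x⁻¹`. [cite: HarishChandra1999, §15 Def. 15.1 and p. 84 (1)] -/
theorem exists_ne_bot_of_forall_apply_eq_self (hcomm : ∀ i j, Commute (f i) (f j)) (hfin : ∀ i, ∃ n : ℕ, 0 < n ∧ f i ^ n = 1) {S : Set ι} {v : W} (hv : v ≠ 0)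
    (hS : ∀ i ∈ S, f i v = v) : ∃ χ : ι → k, (⨅ i, (f i).eigenspace (χ i)) ≠ ⊥ ∧ ∀ i ∈ S, χ i = 1 :=
  exists_ne_bot_of_forall_apply_eq_smul f hcomm hfin (μ := fun _ => 1) hv fun i hi => by rw [one_smul]; exact hS i hi

/-- **A non-zero operator is non-zero on some eigencharacter space** (`⨆_χ W_χ = W`). [folklore] -/
theorem exists_mem_iInf_eigenspace_apply_ne_zero (hcomm : ∀ i j, Commute (f i) (f j)) (hfin : ∀ i, ∃ n : ℕ, 0 < n ∧ f i ^ n = 1) {T : Module.End k W} (hT : T ≠ 0) :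
    ∃ (χ : ι → k) (w : W), w ∈ (⨅ i, (f i).eigenspace (χ i)) ∧ T w ≠ 0 := by
  by_contra h
  push Not at h
  apply hT
  refine LinearMap.ext fun v => ?_
  have hv : v ∈ ⨆ χ : ι → k, ⨅ i, (f i).eigenspace (χ i) := by rw [iSup_iInf_eigenspace_eq_top f hcomm hfin]; exact Submodule.mem_top
  rw [LinearMap.zero_apply]
  refine Submodule.iSup_induction (motive := fun w => T w = 0) _ hv (fun χ w hw => h χ w hw) (map_zero T) fun x y hx hy => ?_
  rw [map_add, hx, hy, add_zero]

/-- **(iii) A TWISTED INTERTWINER MATCHES TWO OCCURRING CHARACTERS**: `T ≠ 0` with `f i ∘ T = T ∘ f (θ i)` for `i ∈ S` ⇒ there are occurring `χ₁`, `χ₂` with `χ₂ i = χ₁ (θ i)` for all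
`i ∈ S` (pick `χ₁` and `w ∈ W_{χ₁}` with `T w ≠ 0`; then `f i (T w) = χ₁ (θ i) • T w` for `i ∈ S`).  In the application `T = P L_y P` (★ p855602 (INT)), `S = A ∩ y A y⁻¹`,
`θ = Ad(y⁻¹)`: «`y` intertwines the type ⇒ `χ₁^y = χ₂` on the overlap», the hypothesis of ★ p855559 `valBound_conj_sub_self_of_intertwines_on_overlap`-type statements.
[cite: HarishChandra1999, §17 Cor. 17.2 and p. 85] [cite: Serre1977, §8.1 Prop. 24] -/
theorem exists_pair_of_twisted_intertwiner (hcomm : ∀ i j, Commute (f i) (f j)) (hfin : ∀ i, ∃ n : ℕ, 0 < n ∧ f i ^ n = 1) {S : Set ι} (θ : ι → ι)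
    {T : Module.End k W} (hT : T ≠ 0) (htw : ∀ i ∈ S, f i * T = T * f (θ i)) :
    ∃ χ₁ χ₂ : ι → k, (⨅ i, (f i).eigenspace (χ₁ i)) ≠ ⊥ ∧ (⨅ i, (f i).eigenspace (χ₂ i)) ≠ ⊥ ∧ ∀ i ∈ S, χ₂ i = χ₁ (θ i) := by
  obtain ⟨χ₁, w, hw, hTw⟩ := exists_mem_iInf_eigenspace_apply_ne_zero f hcomm hfin hT
  have hμ : ∀ i ∈ S, f i (T w) = χ₁ (θ i) • T w := fun i hi => by
    rw [← Module.End.mul_apply, htw i hi, Module.End.mul_apply, apply_eq_smul_of_mem_iInf_eigenspace f hw (θ i), map_smul]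
  obtain ⟨χ₂, hχ₂, hχ₂S⟩ := exists_ne_bot_of_forall_apply_eq_smul f hcomm hfin hTw hμ
  have hw0 : w ≠ 0 := fun h => hTw (by rw [h, map_zero])
  exact ⟨χ₁, χ₂, Submodule.ne_bot_iff _ |>.2 ⟨w, hw, hw0⟩, hχ₂, hχ₂S⟩

end Consequences

/-! ## §4 Permutation of the eigencharacter spaces by normalising operators; the depth criterion -/

section Normaliser

variable {ι : Type*} (f : ι → Module.End k W)

/-- **`u ∘ f i = f (π i) ∘ u` ⇒ `u(W_χ) ⊆ ⨅_i ker(f (π i) − χ i)`**: an operator normalising the family (in the application `u = L_x`, `x ∈ K₁`, `π = Ad(x)` on the layer `A`)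
maps the `χ`-space into the space of the transported character. [cite: Serre1977, §8.1 Prop. 24] -/
theorem apply_mem_iInf_eigenspace_of_forall_mul_eq {u : Module.End k W} {π : ι → ι} (hu : ∀ i, u * f i = f (π i) * u) {χ : ι → k} {w : W}
    (hw : w ∈ ⨅ i, (f i).eigenspace (χ i)) : u w ∈ ⨅ i, (f (π i)).eigenspace (χ i) := by
  refine (Submodule.mem_iInf _).2 fun i => Module.End.mem_eigenspace_iff.2 ?_
  rw [← Module.End.mul_apply, ← hu i, Module.End.mul_apply, apply_eq_smul_of_mem_iInf_eigenspace f hw i, map_smul]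

/-- Reindexed form along a bijection `π` of the index set: `u(W_χ) ⊆ W_{χ ∘ π⁻¹}`. [cite: Serre1977, §8.1 Prop. 24] -/
theorem apply_mem_iInf_eigenspace_comp_symm {u : Module.End k W} (π : ι ≃ ι) (hu : ∀ i, u * f i = f (π i) * u) {χ : ι → k} {w : W}
    (hw : w ∈ ⨅ i, (f i).eigenspace (χ i)) : u w ∈ ⨅ j, (f j).eigenspace (χ (π.symm j)) := by
  have h := apply_mem_iInf_eigenspace_of_forall_mul_eq f hu hw
  refine (Submodule.mem_iInf _).2 fun j => ?_
  have hj := (Submodule.mem_iInf _).1 h (π.symm j)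
  rwa [Equiv.apply_symm_apply] at hj

variable [IsAlgClosed k] [CharZero k] [FiniteDimensional k W]

/-- **THE DEPTH CRITERION: if every occurring character has `χ i = 1` then `f i = 1`** (`⨆_χ W_χ = W` and `f i = χ i` on `W_χ`).  In the application: the type `c` is trivial on a
subgroup `K_m` of the layer iff every occurring character is — the depth of `c` is the largest depth of an occurring `χ = χ_X|_A`, read off `|X|` by ★ p855532 §3.
[cite: HarishChandra1999, §19 Lemma 19.3 and Cor. 19.5] -/
theorem eq_one_of_forall_ne_bot_apply_eq_one (hcomm : ∀ i j, Commute (f i) (f j)) (hfin : ∀ i, ∃ n : ℕ, 0 < n ∧ f i ^ n = 1) {i : ι}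
    (h : ∀ χ : ι → k, (⨅ j, (f j).eigenspace (χ j)) ≠ ⊥ → χ i = 1) : f i = 1 := by
  refine LinearMap.ext fun v => ?_
  have hv : v ∈ ⨆ χ : ι → k, ⨅ j, (f j).eigenspace (χ j) := by rw [iSup_iInf_eigenspace_eq_top f hcomm hfin]; exact Submodule.mem_top
  rw [Module.End.one_apply]
  refine Submodule.iSup_induction (motive := fun w => f i w = w) _ hv (fun χ w hw => ?_) (map_zero _) fun x y hx hy => by rw [map_add, hx, hy]
  rw [apply_eq_smul_of_mem_iInf_eigenspace f hw i]
  by_cases hχ : (⨅ j, (f j).eigenspace (χ j)) = ⊥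
  · rw [hχ, Submodule.mem_bot] at hw
    rw [hw, smul_zero]
  · rw [h χ hχ, one_smul]

/-- **Conversely, the occurring characters detect non-triviality**: `f i ≠ 1` ⇒ some occurring `χ` has `χ i ≠ 1`. [cite: HarishChandra1999, §19 Cor. 19.5] -/
theorem exists_ne_bot_apply_ne_one (hcomm : ∀ i j, Commute (f i) (f j)) (hfin : ∀ i, ∃ n : ℕ, 0 < n ∧ f i ^ n = 1) {i : ι} (hi : f i ≠ 1) :
    ∃ χ : ι → k, (⨅ j, (f j).eigenspace (χ j)) ≠ ⊥ ∧ χ i ≠ 1 := by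
  by_contra h
  push Not at h
  exact hi (eq_one_of_forall_ne_bot_apply_eq_one f hcomm hfin fun χ hχ => h χ hχ)

end Normaliser

end Summit.HodgeConjecture.HodgeConjecture.Cruxes.H413.K2E3AbelianLayerEigencharacters

end
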